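import Summits.PneNP.PneNP.Theorems.RegularResolutionRung.Negative.EmptyGraphLines
import Summits.PneNP.PneNP.Theorems.RamseyUncertifiableResolutionUncertaintyHeavyBlockWidth
import Literature.Computability.Complexity.NegationElimination
import Literature.Computability.MetaComplexity.Resolution

/-!
# Crux `RamseyUncertifiable.ResolutionUncertainty` (stmt-PneNP-9816), line
# `jukna-game-monotone-interpolation`: stub `stub_blockInvariant`

Monotone interpolation for the BLOCK SPLIT of the unary clique formula `Clique(H, k)`
(`cliqueCNF n k adj`, variables `x_{i,v} ↦ i·n + v`), `k = kA + kB`: Alice owns the blocks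
`i < kA`, Bob the blocks `kA ≤ i < k` and every junk variable `w ≥ k·n`.  Given a generic
straight-line monotone extraction along a line sequence (one gate per line: Alice pivot ↦ `∨`,
Bob pivot ↦ `∧`, weakening ↦ the premise's wire, initial clause ↦ a leaf), a resolution
refutation `π` of `Clique(H, k)` yields a circuit over `{∧₂, ∨₂, 0, 1}` on the vertex inputs
`z : Fin n → Bool`, of size `≤ |π|`, accepting the indicator of every `kA`-clique of `H` and
rejecting the shadow `A ∩ N(y)` of every `kB`-clique `y`.

Proof.  Leaves (`axiom_leaf`, via the clause families `cliqueCNF_cases'`): pure Alice axiom ↦ `0`,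
pure Bob axiom ↦ `1`, cross edge axiom `¬x_{i,u} ∨ ¬x_{j,w}` (`i < kA ≤ j`, `u ≁ w`) ↦ the input
`z_u`; a clique enumeration's block assignment falsifies no pure axiom of its own side
(`not_fals_funct`, `not_fals_edge`), `z_u = 1` on cliques through `u`, `z_u = 0` on shadows of
cliques through `w`.  Propagation (`invariant_side`, ONE generic lemma serving both sides, strong
induction along `π`): if every initial line all of whose owned literals are falsified by a fixed
assignment has value `b` at a fixed input, then so has every such line — at an owned pivot the
assignment falsifies the erased pivot literal of one premise and `b` is absorbing for that gate
(`resolve_split`); at a foreign pivot the owned parts of both premises lie in the resolvent and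
the gate is idempotent (`resolve_both`); weakening restricts.  Alice: owned = block `< kA`,
`b = 1`, input = range indicator of a clique enumeration `α : Fin kA → Fin n`, assignment
`x_{i,v} := (α i = v)`; Bob: owned = block `≥ kA` (junk included), `b = 0`, input = shadow of the
range of `β : Fin kB → Fin n`, assignment `x_{kA+j,v} := (β j = v)`, junk false.  At an empty
clause the hypothesis is vacuous.  No soundness, restriction or width argument is used.
[J. Krajíček, *Interpolation theorems, lower bounds for proof systems, and independence results
for bounded arithmetic*, J. Symbolic Logic 62 (1997), §6; M. Karchmer, A. Wigderson, *Monotone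
circuits for connectivity require super-logarithmic depth*, SIAM J. Discrete Math. 3 (1990);
S. Jukna, *Clique problem, cutting plane proofs and communication complexity*, arXiv:1203.5414,
Thm 2 (the clique game) — adaptation / folklore]
-/

-- `Summit.PneNP.PneNP.…` repeats `PneNP` by the tree's layout (summit = problem); silence the core linter as the landed siblings do.
set_option linter.dupNamespace false

namespace Summit.PneNP.PneNP.Theorems.RamseyUncertifiableResolutionUncertainty

namespace BlockInvariant

open scoped Classical
open Literature.Computability.Complexity Literature.Computability.MetaComplexity
open Summit.PneNP.PneNP.Theorems.RegularResolutionRung.Negative (cliqueCNF)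

variable {n m : ℕ} {γ : Fin m → Fin n} {blk : Fin m → ℕ}

/-! ## Block variables and block assignments -/

/-- The block of a block variable: `(i·n + v) / n = i` for `v < n`. -/
theorem blockVar_div (i : ℕ) (v : Fin n) : (i * n + (v : ℕ)) / n = i := by
  rw [Nat.add_comm, Nat.add_mul_div_right _ _ v.pos, Nat.div_eq_of_lt v.isLt, Nat.zero_add]

/-- The block assignment `x_{blk a, γ a} := 1` (else `0`) of an enumeration `γ : Fin m → Fin n`
placed injectively on the blocks `blk a` falsifies no functionality clause `¬x_{i,u} ∨ ¬x_{i,v}`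
(`u ≠ v`) … -/
theorem not_fals_funct (i : ℕ) {u v : Fin n} (huv : u ≠ v)
    (hu : ∃ a, blk a * n + (γ a : ℕ) = i * n + (u : ℕ))
    (hv : ∃ a, blk a * n + (γ a : ℕ) = i * n + (v : ℕ)) (hblk : Function.Injective blk) :
    False := by
  obtain ⟨a, ha⟩ := hu
  obtain ⟨b, hb⟩ := hv
  obtain ⟨ha1, rfl⟩ := blockVar_inj ha
  obtain ⟨hb1, rfl⟩ := blockVar_inj hb
  exact huv (by rw [hblk (ha1.trans hb1.symm)])

/-- … and, if `γ` enumerates a clique, no edge clause `¬x_{i,u} ∨ ¬x_{j,v}` (`i ≠ j`, `u ≁ v`). -/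
theorem not_fals_edge {G : SimpleGraph (Fin n)} (hγ : ∀ a b, a ≠ b → G.Adj (γ a) (γ b))
    (i j : ℕ) (hij : i ≠ j) {u v : Fin n} (hadj : ¬ G.Adj u v)
    (hu : ∃ a, blk a * n + (γ a : ℕ) = i * n + (u : ℕ))
    (hv : ∃ a, blk a * n + (γ a : ℕ) = j * n + (v : ℕ)) : False := by
  obtain ⟨a, ha⟩ := hu
  obtain ⟨b, hb⟩ := hv
  obtain ⟨ha1, rfl⟩ := blockVar_inj ha
  obtain ⟨hb1, rfl⟩ := blockVar_inj hb
  exact hadj (hγ a b fun hab => hij (by rw [← ha1, ← hb1, hab]))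

/-! ## One side of the invariant: generic straight-line bookkeeping -/

variable {isOr : ℕ → Bool} {b : Bool} {Q : ℕ → Prop} {C D : Finset (Literal ℕ)} {v : ℕ}

/-- Backward resolution step, owned pivot.  A literal `l` is OWNED if `isOr l.1 = b` and
FALSIFIED if `Q l.1 ↔ l.2 = false` (`Q` = the variables assigned true).  If every owned literal
of the resolvent `(C - x_v) ∪ (D - ¬x_v)` is falsified, then so is every owned literal of `C`
(if `x_v` is false) or of `D` (if `x_v` is true). -/
theorem resolve_split
    (h : ∀ l ∈ C.erase (v, true) ∪ D.erase (v, false), isOr l.1 = b → (Q l.1 ↔ l.2 = false)) :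
    (∀ l ∈ C, isOr l.1 = b → (Q l.1 ↔ l.2 = false)) ∨
      (∀ l ∈ D, isOr l.1 = b → (Q l.1 ↔ l.2 = false)) := by
  by_cases hq : Q v
  · refine Or.inr fun l hl hown => ?_
    by_cases hlv : l = (v, false)
    · subst hlv
      simpa using hq
    · exact h l (Finset.mem_union_right _ (Finset.mem_erase.2 ⟨hlv, hl⟩)) hown
  · refine Or.inl fun l hl hown => ?_
    by_cases hlv : l = (v, true)
    · subst hlv
      simpa using hq
    · exact h l (Finset.mem_union_left _ (Finset.mem_erase.2 ⟨hlv, hl⟩)) hown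

/-- Backward resolution step, foreign pivot: the owned literals of both premises lie in the
resolvent. -/
theorem resolve_both (hv : ¬ isOr v = b)
    (h : ∀ l ∈ C.erase (v, true) ∪ D.erase (v, false), isOr l.1 = b → (Q l.1 ↔ l.2 = false)) :
    (∀ l ∈ C, isOr l.1 = b → (Q l.1 ↔ l.2 = false)) ∧
      (∀ l ∈ D, isOr l.1 = b → (Q l.1 ↔ l.2 = false)) := by
  refine ⟨fun l hl hown => h l (Finset.mem_union_left _ (Finset.mem_erase.2 ⟨?_, hl⟩)) hown,
    fun l hl hown => h l (Finset.mem_union_right _ (Finset.mem_erase.2 ⟨?_, hl⟩)) hown⟩ <;>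
  · rintro rfl
    exact hv hown

/-- **One side of the interpolation invariant.**  Let `val` obey the gate recursion along a
derivation `π` at the input `z` (`isOr`-pivots ↦ `∨`, other pivots ↦ `∧`, weakening ↦ the
premise's value).  If every INITIAL line all of whose owned literals are falsified has value `b`,
then so has EVERY line all of whose owned literals are falsified (strong induction along `π`: at
an owned pivot one premise qualifies by `resolve_split` and `b` is absorbing for the gate; at a
foreign pivot both premises qualify by `resolve_both` and the gate is idempotent). -/
theorem invariant_side {ι : Type} {φ : CNF ℕ} {π : List (ResLine ℕ)} (hder : IsResDerivation φ π)
    (isOr : ℕ → Bool) (b : Bool) (Q : ℕ → Prop) {val : ℕ → (ι → Bool) → Bool} (z : ι → Bool)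
    (hinit : ∀ t (ht : t < π.length), (π[t]).rule = .initial →
      (∀ l ∈ (π[t]).clause, isOr l.1 = b → (Q l.1 ↔ l.2 = false)) → val t z = b)
    (hres : ∀ t (ht : t < π.length) (i j v : ℕ), (π[t]).rule = .resolve i j v →
      val t z = if isOr v then (val i z || val j z) else (val i z && val j z))
    (hweak : ∀ t (ht : t < π.length) (i : ℕ), (π[t]).rule = .weaken i → val t z = val i z) :
    ∀ t (ht : t < π.length),
      (∀ l ∈ (π[t]).clause, isOr l.1 = b → (Q l.1 ↔ l.2 = false)) → val t z = b := by
  intro t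
  induction t using Nat.strong_induction_on with
  | _ t ih =>
    intro ht hfal
    have hv := hder t ht
    have hlen : (π.take t).length = t := by simp [ht.le]
    unfold IsValidResLine at hv
    split at hv
    · next heq => exact hinit t ht heq hfal
    · next i j v heq =>
      obtain ⟨hi, hj, -, -, hE⟩ := hv
      rw [List.getElem_take, List.getElem_take] at hE
      obtain ⟨hit, hjt⟩ : i < t ∧ j < t := ⟨by omega, by omega⟩
      rw [hres t ht i j v heq]
      rw [hE] at hfal
      by_cases hvb : isOr v = b
      · rw [hvb]
        rcases resolve_split hfal with h | h
        · rw [ih i hit (hit.trans ht) h]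
          cases b <;> simp
        · rw [ih j hjt (hjt.trans ht) h]
          cases b <;> simp
      · obtain ⟨h₁, h₂⟩ := resolve_both hvb hfal
        rw [ih i hit (hit.trans ht) h₁, ih j hjt (hjt.trans ht) h₂, Bool.or_self, Bool.and_self,
          ite_self]
    · next i heq =>
      obtain ⟨hi, hsub⟩ := hv
      rw [List.getElem_take] at hsub
      have hit : i < t := by omega
      rw [hweak t ht i heq]
      exact ih i hit (hit.trans ht) fun l hl => hfal l (hsub hl)

/-- Premise indices of a derivation point backwards. -/
theorem premises_lt {φ : CNF ℕ} {π : List (ResLine ℕ)} (hder : IsResDerivation φ π)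
    (t : ℕ) (ht : t < π.length) : ∀ i ∈ (π[t]).premises, i < t := by
  have hv := hder t ht
  have hlen : (π.take t).length = t := by simp [ht.le]
  unfold IsValidResLine at hv
  unfold ResLine.premises
  split at hv
  · next heq => simp [heq, ResRule.premises]
  · next i j v heq =>
    obtain ⟨hi, hj, -⟩ := hv
    obtain ⟨hit, hjt⟩ : i < t ∧ j < t := ⟨by omega, by omega⟩
    simp [heq, ResRule.premises, hit, hjt]
  · next i heq =>
    obtain ⟨hi, -⟩ := hv
    have hit : i < t := by omega
    simp [heq, ResRule.premises, hit]

/-! ## The axioms of `Clique(H, kA + kB)` and their leaves -/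

/-- The three clause families of `cliqueCNF`, read back as finsets, the block clauses in closed
form. -/
-- adapted from `cliqueCNF_cases` (RamseyUncertifiableResolutionUncertaintyHeavyBlockWidth)
theorem cliqueCNF_cases' {k : ℕ} {adj : Fin n → Fin n → Bool} {c : Clause ℕ}
    (hc : c ∈ cliqueCNF n k adj) :
    (∃ i < k, c.toFinset = Finset.univ.image fun v : Fin n => (i * n + (v : ℕ), true)) ∨
    (∃ i < k, ∃ u v : Fin n, u ≠ v ∧
      c.toFinset = {(i * n + (u : ℕ), false), (i * n + (v : ℕ), false)}) ∨
    (∃ i < k, ∃ j < k, ∃ u v : Fin n, i ≠ j ∧ adj u v = false ∧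
      c.toFinset = {(i * n + (u : ℕ), false), (j * n + (v : ℕ), false)}) := by
  unfold cliqueCNF at hc
  rcases List.mem_append.1 hc with hc | hc
  · rcases List.mem_append.1 hc with hc | hc
    · obtain ⟨i, hi, rfl⟩ := List.mem_map.1 hc
      refine Or.inl ⟨i, List.mem_range.1 hi, ?_⟩
      ext l
      simp
    · obtain ⟨i, hi, hc⟩ := List.mem_flatMap.1 hc
      obtain ⟨u, hu, hc⟩ := List.mem_flatMap.1 hc
      obtain ⟨v, hv, hc⟩ := List.mem_flatMap.1 hc
      obtain ⟨u, rfl⟩ : ∃ a : Fin n, u = (a : ℕ) := by simpa using hu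
      obtain ⟨v, rfl⟩ : ∃ a : Fin n, v = (a : ℕ) := by simpa using hv
      split_ifs at hc with huv
      · rw [List.mem_singleton.1 hc]
        refine Or.inr (Or.inl ⟨i, List.mem_range.1 hi, u, v, fun h => ?_, by simp⟩)
        subst h
        exact lt_irrefl _ huv
      · simp at hc
  · obtain ⟨i, hi, hc⟩ := List.mem_flatMap.1 hc
    obtain ⟨j, hj, hc⟩ := List.mem_flatMap.1 hc
    obtain ⟨u, -, hc⟩ := List.mem_flatMap.1 hc
    obtain ⟨v, -, hc⟩ := List.mem_flatMap.1 hc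
    split_ifs at hc with hcond
    · rw [List.mem_singleton.1 hc]
      exact Or.inr (Or.inr ⟨i, List.mem_range.1 hi, j, List.mem_range.1 hj, u, v, hcond.1,
        hcond.2, by simp⟩)
    · simp at hc

variable (H : SimpleGraph (Fin n)) [DecidableRel H.Adj] (A : Finset (Fin n)) (kA kB : ℕ)

/-- **Leaves.**  Every clause `D` has a leaf `lf ∈ {0, 1, z_u}` such that, if `D` is an axiom of
`Clique(H, kA + kB)`: (P) the leaf is `1` at the range indicator of every clique enumeration
`α : Fin kA → Fin n` whose block assignment (`α a` in block `a`) falsifies every Alice literal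
(block `< kA`) of `D`; (N) the leaf is `0` at the shadow `A ∩ N(range β)` of every clique
enumeration `β : Fin kB → Fin n` whose block assignment (`β a` in block `kA + a`, junk variables
false) falsifies every Bob literal (block `≥ kA`) of `D`.  Pure Alice axiom ↦ `0`, pure Bob axiom
↦ `1` (no pure axiom is falsified by its own side), cross axiom `¬x_{i,u} ∨ ¬x_{j,w}` ↦ `z_u`. -/
theorem axiom_leaf {k : ℕ} (hk : kA + kB = k) (D : Finset (Literal ℕ)) :
    ∃ lf : Fin n ⊕ Bool, D ∈ (cliqueCNF n k fun u v => decide (H.Adj u v)).clauseFinsets →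
      (∀ α : Fin kA → Fin n, (∀ a b, a ≠ b → H.Adj (α a) (α b)) →
        (∀ l ∈ D, decide (l.1 / n < kA) = true →
          ((∃ a : Fin kA, (a : ℕ) * n + (α a : ℕ) = l.1) ↔ l.2 = false)) →
        Sum.elim (fun v => decide (∃ a, α a = v)) id lf = true) ∧
      (∀ β : Fin kB → Fin n, (∀ a b, a ≠ b → H.Adj (β a) (β b)) →
        (∀ l ∈ D, decide (l.1 / n < kA) = false →
          ((∃ a : Fin kB, (kA + (a : ℕ)) * n + (β a : ℕ) = l.1) ↔ l.2 = false)) →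
        Sum.elim (fun v => decide (v ∈ A ∧ ∀ a, H.Adj v (β a))) id lf = false) := by
  by_cases hD : D ∉ (cliqueCNF n k fun u v => decide (H.Adj u v)).clauseFinsets
  · exact ⟨.inr true, fun h => (hD h).elim⟩
  obtain ⟨c, hc, rfl⟩ := List.mem_map.1 (not_not.1 hD)
  have hBinj : Function.Injective fun a : Fin kB => kA + (a : ℕ) :=
    fun a b h => Fin.ext (Nat.add_left_cancel h)
  rcases cliqueCNF_cases' hc with ⟨i, hi, hcD⟩ | ⟨i, hi, u, v, huv, hcD⟩ |
      ⟨i, hi, j, hj, u, v, hij, hadj, hcD⟩ <;> rw [hcD] <;> clear hD hcD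
  · -- block clause of block `i`: the own side's enumeration has a vertex in block `i`
    by_cases hiA : i < kA
    · refine ⟨.inr false, fun _ => ⟨fun α _ hα => ?_, fun _ _ _ => rfl⟩⟩
      have h := (hα (i * n + (α ⟨i, hiA⟩ : ℕ), true) (by simp) (by simp [blockVar_div, hiA])).1
        ⟨⟨i, hiA⟩, rfl⟩
      exact Bool.noConfusion h
    · refine ⟨.inr true, fun _ => ⟨fun _ _ _ => rfl, fun β _ hβ => ?_⟩⟩
      have hiB : i - kA < kB := by omega
      have h := (hβ (i * n + (β ⟨i - kA, hiB⟩ : ℕ), true) (by simp) (by simp [blockVar_div, hiA])).1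
        ⟨⟨i - kA, hiB⟩, by simp [Nat.add_sub_cancel' (Nat.le_of_not_lt hiA)]⟩
      exact Bool.noConfusion h
  · -- functionality clause of block `i`
    by_cases hiA : i < kA
    · refine ⟨.inr false, fun _ => ⟨fun α _ hα => ?_, fun _ _ _ => rfl⟩⟩
      exact (not_fals_funct i huv
        ((hα (i * n + (u : ℕ), false) (by simp) (by simp [blockVar_div, hiA])).2 rfl)
        ((hα (i * n + (v : ℕ), false) (by simp) (by simp [blockVar_div, hiA])).2 rfl)
        Fin.val_injective).elim
    · refine ⟨.inr true, fun _ => ⟨fun _ _ _ => rfl, fun β _ hβ => ?_⟩⟩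
      exact (not_fals_funct i huv
        ((hβ (i * n + (u : ℕ), false) (by simp) (by simp [blockVar_div, hiA])).2 rfl)
        ((hβ (i * n + (v : ℕ), false) (by simp) (by simp [blockVar_div, hiA])).2 rfl)
        hBinj).elim
  · -- edge clause between blocks `i ≠ j`
    have hadj' : ¬ H.Adj u v := by simpa using hadj
    by_cases hiA : i < kA <;> by_cases hjA : j < kA
    · refine ⟨.inr false, fun _ => ⟨fun α hαc hα => ?_, fun _ _ _ => rfl⟩⟩
      exact (not_fals_edge hαc i j hij hadj'
        ((hα (i * n + (u : ℕ), false) (by simp) (by simp [blockVar_div, hiA])).2 rfl)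
        ((hα (j * n + (v : ℕ), false) (by simp) (by simp [blockVar_div, hjA])).2 rfl)).elim
    · -- cross axiom, Alice vertex `u`
      refine ⟨.inl u, fun _ => ⟨fun α _ hα => ?_, fun β _ hβ => ?_⟩⟩
      · obtain ⟨a, ha⟩ := (hα (i * n + (u : ℕ), false) (by simp) (by simp [blockVar_div, hiA])).2 rfl
        rw [Sum.elim_inl, decide_eq_true_eq]
        exact ⟨a, (blockVar_inj ha).2⟩
      · obtain ⟨a, ha⟩ := (hβ (j * n + (v : ℕ), false) (by simp) (by simp [blockVar_div, hjA])).2 rfl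
        rw [Sum.elim_inl, decide_eq_false_iff_not]
        exact fun h => hadj' ((blockVar_inj ha).2 ▸ h.2 a)
    · -- cross axiom, Alice vertex `v`
      refine ⟨.inl v, fun _ => ⟨fun α _ hα => ?_, fun β _ hβ => ?_⟩⟩
      · obtain ⟨a, ha⟩ := (hα (j * n + (v : ℕ), false) (by simp) (by simp [blockVar_div, hjA])).2 rfl
        rw [Sum.elim_inl, decide_eq_true_eq]
        exact ⟨a, (blockVar_inj ha).2⟩
      · obtain ⟨a, ha⟩ := (hβ (i * n + (u : ℕ), false) (by simp) (by simp [blockVar_div, hiA])).2 rfl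
        rw [Sum.elim_inl, decide_eq_false_iff_not]
        exact fun h => hadj' (H.adj_symm ((blockVar_inj ha).2 ▸ h.2 a))
    · refine ⟨.inr true, fun _ => ⟨fun _ _ _ => rfl, fun β hβc hβ => ?_⟩⟩
      exact (not_fals_edge hβc i j hij hadj'
        ((hβ (i * n + (u : ℕ), false) (by simp) (by simp [blockVar_div, hiA])).2 rfl)
        ((hβ (j * n + (v : ℕ), false) (by simp) (by simp [blockVar_div, hjA])).2 rfl)).elim

/-- The range of the increasing enumeration of a finset is the finset. -/
theorem exists_orderEmbOfFin_eq_iff {x : Finset (Fin n)} {k : ℕ} (hx : x.card = k) (v : Fin n) :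
    (∃ i, x.orderEmbOfFin hx i = v) ↔ v ∈ x := by
  refine ⟨fun ⟨i, hi⟩ => hi ▸ Finset.orderEmbOfFin_mem x hx i, fun hv => Set.mem_range.1 ?_⟩
  rw [Finset.range_orderEmbOfFin]
  exact hv

end BlockInvariant

open scoped Classical
open Literature.Computability.Complexity Literature.Computability.MetaComplexity
open Summit.PneNP.PneNP.Theorems.RegularResolutionRung.Negative (cliqueCNF)

/-- **Block-split monotone interpolation for `Clique(H, kA + kB)`** (Krajíček 1997 /
Karchmer–Wigderson; the size form of Jukna's clique game).  Assuming generic monotone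
straight-line extraction along a line sequence (the first hypothesis), every resolution
refutation `π` of the unary clique CNF `cliqueCNF n ⌈log₂ n²⌉ (H.Adj)` yields a circuit over
`{∧₂, ∨₂, 0, 1}` on the vertex inputs, of size `≤ |π|`, accepting the indicator of every
`kA`-clique of `H` and rejecting the shadow `A ∩ N(y)` of every `kB`-clique `y`
(`kA + kB = ⌈log₂ n²⌉`).  Instantiate the extraction with `isOr w := decide (w / n < kA)` and
the leaves of `BlockInvariant.axiom_leaf`, and run `BlockInvariant.invariant_side` for each side
up to an empty clause, on the increasing enumeration of `x`, resp. `y`. -/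
theorem stub_blockInvariant :
    (∀ (ι : Type) (π : List (ResLine ℕ)) (isOr : ℕ → Bool) (leaf : ℕ → ι ⊕ Bool) (r : ℕ),
      r < π.length →
      (∀ t (ht : t < π.length), ∀ i ∈ (π[t]'ht).premises, i < t) →
      ∃ (C : Circuit ι) (val : ℕ → (ι → Bool) → Bool),
        C.IsOver monotoneBasis01 ∧ C.size ≤ π.length ∧ (∀ z, C.eval z = val r z) ∧
        ∀ t (ht : t < π.length) (z : ι → Bool),
          val t z =
            (match (π[t]'ht).rule with
              | .initial => Sum.elim z id (leaf t)
              | .resolve i j v => if isOr v then (val i z || val j z) else (val i z && val j z)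
              | .weaken i => val i z)) →
    ∀ (n : ℕ) (H : SimpleGraph (Fin n)) [DecidableRel H.Adj] (A : Finset (Fin n)) (kA kB : ℕ),
      kA + kB = Nat.clog 2 (n ^ 2) →
      ∀ π : List (ResLine ℕ),
        IsResRefutation (cliqueCNF n (Nat.clog 2 (n ^ 2)) fun u v => decide (H.Adj u v)) π →
        ∃ C : Circuit (Fin n), C.IsOver monotoneBasis01 ∧ C.size ≤ π.length ∧
          (∀ x : Finset (Fin n), H.IsNClique kA x → C.eval (fun v => decide (v ∈ x)) = true) ∧
          (∀ y : Finset (Fin n), H.IsNClique kB y →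
            C.eval (fun v => decide (v ∈ A ∧ ∀ w ∈ y, H.Adj v w)) = false) := by
  intro hME n H _ A kA kB hk π hπ
  obtain ⟨hder, l, hl, hle⟩ := hπ
  obtain ⟨r, hr, rfl⟩ := List.mem_iff_getElem.1 hl
  -- initial lines are axioms; choose their leaves by `axiom_leaf`
  have hval : ∀ t (ht : t < π.length), (π[t]).rule = .initial → (π[t]).clause ∈
      (cliqueCNF n (Nat.clog 2 (n ^ 2)) fun u v => decide (H.Adj u v)).clauseFinsets :=
    fun t ht heq => by simpa only [IsValidResLine, heq] using hder t ht
  obtain ⟨C, val, hover, hsize, heval, hrec⟩ := hME (Fin n) π (fun w => decide (w / n < kA))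
    (fun t => if ht : t < π.length then
      Classical.choose (BlockInvariant.axiom_leaf H A kA kB hk (π[t]).clause) else .inr true)
    r hr (BlockInvariant.premises_lt hder)
  have hres : ∀ z t (ht : t < π.length) (i j v : ℕ), (π[t]).rule = .resolve i j v →
      val t z = if decide (v / n < kA) then (val i z || val j z) else (val i z && val j z) :=
    fun z t ht i j v heq => by simpa only [heq] using hrec t ht z
  have hweak : ∀ z t (ht : t < π.length) (i : ℕ), (π[t]).rule = .weaken i → val t z = val i z :=
    fun z t ht i heq => by simpa only [heq] using hrec t ht z
  have hinit : ∀ z t (ht : t < π.length), (π[t]).rule = .initial → val t z =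
      Sum.elim z id (Classical.choose (BlockInvariant.axiom_leaf H A kA kB hk (π[t]).clause)) :=
    fun z t ht heq => by simpa only [heq, dif_pos ht] using hrec t ht z
  refine ⟨C, hover, hsize, fun x hx => ?_, fun y hy => ?_⟩
  · -- accept the `kA`-clique `x`, enumerated increasingly by `e`
    have hec : ∀ a b, a ≠ b →
        H.Adj (x.orderEmbOfFin hx.card_eq a) (x.orderEmbOfFin hx.card_eq b) :=
      fun a b hab => hx.isClique (x.orderEmbOfFin_mem _ a) (x.orderEmbOfFin_mem _ b)
        fun h => hab ((x.orderEmbOfFin hx.card_eq).injective h)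
    have key : (fun v => decide (v ∈ x)) = fun v => decide (∃ a, x.orderEmbOfFin hx.card_eq a = v) :=
      funext fun v => decide_eq_decide.2 (BlockInvariant.exists_orderEmbOfFin_eq_iff _ v).symm
    rw [heval, key]
    refine BlockInvariant.invariant_side hder (fun w => decide (w / n < kA)) true
      (fun w => ∃ a : Fin kA, (a : ℕ) * n + (x.orderEmbOfFin hx.card_eq a : ℕ) = w) _
      (fun t ht heq hfal => ?_) (hres _) (hweak _) r hr (by simp [hle])
    rw [hinit _ t ht heq]
    exact (Classical.choose_spec (BlockInvariant.axiom_leaf H A kA kB hk (π[t]).clause)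
      (hval t ht heq)).1 _ hec hfal
  · -- reject the shadow of the `kB`-clique `y`, enumerated increasingly by `e`
    have hec : ∀ a b, a ≠ b →
        H.Adj (y.orderEmbOfFin hy.card_eq a) (y.orderEmbOfFin hy.card_eq b) :=
      fun a b hab => hy.isClique (y.orderEmbOfFin_mem _ a) (y.orderEmbOfFin_mem _ b)
        fun h => hab ((y.orderEmbOfFin hy.card_eq).injective h)
    have key : (fun v => decide (v ∈ A ∧ ∀ w ∈ y, H.Adj v w)) =
        fun v => decide (v ∈ A ∧ ∀ a, H.Adj v (y.orderEmbOfFin hy.card_eq a)) := by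
      funext v
      refine decide_eq_decide.2 (and_congr_right fun _ => ⟨fun h a => h _ ?_, fun h w hw => ?_⟩)
      · exact (BlockInvariant.exists_orderEmbOfFin_eq_iff _ _).1 ⟨a, rfl⟩
      · obtain ⟨a, rfl⟩ := (BlockInvariant.exists_orderEmbOfFin_eq_iff hy.card_eq w).2 hw
        exact h a
    rw [heval, key]
    refine BlockInvariant.invariant_side hder (fun w => decide (w / n < kA)) false
      (fun w => ∃ a : Fin kB, (kA + (a : ℕ)) * n + (y.orderEmbOfFin hy.card_eq a : ℕ) = w) _
      (fun t ht heq hfal => ?_) (hres _) (hweak _) r hr (by simp [hle])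
    rw [hinit _ t ht heq]
    exact (Classical.choose_spec (BlockInvariant.axiom_leaf H A kA kB hk (π[t]).clause)
      (hval t ht heq)).2 _ hec hfal

end Summit.PneNP.PneNP.Theorems.RamseyUncertifiableResolutionUncertainty
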